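import Literature.Topology.FourManifolds.ThickenedHandlebodyFour
import Literature.Topology.FourManifolds.HandlebodyMirrorSymmetry
import Literature.Topology.FourManifolds.SPC4OneHandlebodyBoundaryProofs
import HarnessLib

/-!
# Mirror-symmetric `4`-dimensional `1`-handlebodies in `ℝ⁴`: the orientation-reversing,
# extendable symmetry of the boundary

Topic `Literature/Topology/FourManifolds`; fact seat
`provefact-Literature.Topology.FourManifolds.exists_diffeomorph_comp_incl_eq` (Laudenbach–Poénaru's
extension theorem), brick **SYMMᴹ** of the DAG of `SPC4HandlesModelReduction.lean`
(`Literature.Topology.FourManifolds.exists_oneHandlebody_diffeoExtends_isOrientationReversing`: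
*for every `k` some compact connected orientable `4`-manifold with boundary with one `0`-handle
and `k` `1`-handles has a boundary datum carrying a self-diffeomorphism `ρ₀` that extends over
the body, reverses every orientation of the boundary, fixes a point `z₀` and induces the
identity of `π₁(∂, z₀)`*).  This file proves **everything in SYMMᴹ except the
`π₁`-triviality**, for the models `{q(x, y) + z² + w² ≤ c} ⊂ ℝ⁴` of
`ThickenedHandlebodyFour.lean`, by the mechanism of `HandlebodyMirrorSymmetry.lean` one
dimension up:

* §1 `Literature.Topology.FourManifolds.reflectFourthCLE`, `reflectFourth` — the reflection
  `(x, y, z, w) ↦ (x, y, z, -w)` of `ℝ⁴` (Mathlib's `((ℝ ∙ e₃)ᗮ).reflection`) as a linear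
  isometry / diffeomorphism, its coordinates, Jacobian determinant `-1`
  (`det_reflectFourthCLE`, Mathlib `Submodule.det_reflection`) and orientation character: it
  reverses the standard orientation of `ℝ⁴` at every point
  (`reflectFourth_isOrientationReversing`; Hirsch, *Differential Topology* (1976), Ch. 4 §4,
  p. 105: "reflection in a hyperplane always reverses orientation").
* §2 **The mechanism** (`RegularSublevel.mirror₄`, `boundaryMirror₄`, `incl_mirror₄`,
  `mirror₄_incl`, `mirror₄_isOrientationReversing`, `boundaryMirror₄_isOrientationReversing`):
  for *any* smooth `G : ℝ⁴ → ℝ` invariant under `w ↦ -w` and any regular level `c`, the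
  reflection induces a self-diffeomorphism `R₀` of `{G ≤ c}` (`RegularSublevel.mapDiffeomorph`,
  `RegularSublevelMaps.lean`) and `r₀` of its boundary `{G = c}` with `R₀ ∘ incl = incl ∘ r₀`
  (so `r₀` *extends*, `diffeoExtends_boundaryMirror₄`); `R₀` reverses the orientation induced
  from `ℝ⁴` (cancel the orientation-preserving inclusion against the reversing reflection,
  `IsOrientationPreserving.of_comp_left`), hence `r₀` reverses the boundary orientation
  (`SmoothOrientation.boundary`, `Diffeomorph.isOrientationReversing_boundaryMap`,
  `BoundaryOrientation.lean`), hence **every** orientation of the boundary when the latter is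
  connected (`boundaryMirror₄_isOrientationReversing_all`; two orientations on a connected
  manifold), which is the case for a compact connected `1`-handlebody
  (`connectedSpace_boundary_of_isHandlebodyOfIndexLE_one_holds`,
  `SPC4OneHandlebodyBoundaryProofs.lean`); and `r₀` fixes the boundary points of the mirror
  `{w = 0}` (`boundaryMirror₄_eq_self_of_apply_three_eq_zero`).
* §3 **The models** (`IsHoledDiscMorseFunction.fourThickening_symm`,
  `exists_oneHandlebody_mirror_four`): for every `k`, the `1`-handlebody
  `Y = {q(x, y) + z² + w² ≤ c}` of `ThickenedHandlebodyFour.lean` (one `0`-handle, `k`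
  `1`-handles, compact, connected, orientable), its boundary datum `∂Y = {q + z² + w² = c}`,
  the restriction `ρ₀` of the reflection, and the base point `z₀ = (u₀, 0, 0)` with
  `q(u₀) = c` satisfy: `ρ₀` extends over `Y`, reverses every smooth orientation of `∂Y`, and
  fixes `z₀`.  What remains of SYMMᴹ is that `ρ₀` induces the identity of `π₁(∂Y, z₀)`
  (the free group `π₁(#ᵏ S¹ × S²)` being generated by loops in the mirror; sequel file).

Laudenbach–Poénaru use such a reflection on the `X_p` side (Bull. SMF 100 (1972), §2,
p. 342, diagram (5): "`F ∈ Diff(X_p)` with `F` orientation-reversing and `(F₁)_# =` the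
identity"); one dimension lower this is Juhász's remark "every handlebody admits an
orientation-reversing symmetry" (*Differential and Low-Dimensional Topology* (2023), §3.5,
p. 97), formalised in `HandlebodyMirrorSymmetry.lean`.  Everything here is **proved**.

## References

* F. Laudenbach, V. Poénaru, *A note on 4-dimensional handlebodies*, Bull. Soc. Math. France
  100 (1972), 337–344, §2, p. 342. [LaudenbachPoenaruBSMF1972]
* M. W. Hirsch, *Differential Topology*, GTM 33 (1976), Ch. 4 §4, pp. 101–105. [HirschDT1976]
* A. Juhász, *Differential and Low-Dimensional Topology*, LMS Student Texts 104 (2023), §3.5,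
  p. 97; §6.1. [Juhasz2023]
-/

open scoped Manifold ContDiff Topology InnerProductSpace
open Set Function Filter Module

noncomputable section

namespace Literature.Topology.FourManifolds

universe u

/-- Local notation: `𝔼 n` is the model Euclidean space `EuclideanSpace ℝ (Fin n)`. -/
local notation "𝔼 " n:arg => EuclideanSpace ℝ (Fin n)

/-! ### §1 The reflection of `ℝ⁴` in the hyperplane `{w = 0}` -/

section Reflection

/-- The fourth standard basis vector `e₃ = (0, 0, 0, 1)` of `ℝ⁴`. [folklore] -/
def e₃four : 𝔼 4 := EuclideanSpace.single (3 : Fin 4) (1 : ℝ)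

/-- The coordinates of `e₃`. [folklore] -/
@[simp] theorem e₃four_apply (i : Fin 4) : e₃four i = if i = 3 then 1 else 0 := by
  simp [e₃four]

/-- `e₃ ≠ 0`. [folklore] -/
theorem e₃four_ne_zero : e₃four ≠ 0 := by
  intro h
  have := congrArg (fun v : 𝔼 4 => v 3) h
  simp at this

/-- **The reflection of `ℝ⁴` in the coordinate hyperplane `{w = 0}`**,
`(x, y, z, w) ↦ (x, y, z, -w)`, as Mathlib's hyperplane reflection `((ℝ ∙ e₃)ᗮ).reflection`
(a linear isometry). [folklore] -/
def reflectFourthCLE : 𝔼 4 ≃L[ℝ] 𝔼 4 := ((ℝ ∙ e₃four)ᗮ).reflection.toContinuousLinearEquiv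

/-- The reflection in coordinates-free form: `R p = p - 2 p₃ e₃`. [folklore] -/
theorem reflectFourthCLE_apply (p : 𝔼 4) : reflectFourthCLE p = p - (2 * p 3) • e₃four := by
  show ((ℝ ∙ e₃four)ᗮ).reflection p = _
  rw [Submodule.reflection_orthogonal_apply, Submodule.reflection_singleton_apply]
  have hn : ‖e₃four‖ = 1 := by simp [e₃four]
  have hip : ⟪e₃four, p⟫_ℝ = p 3 := by simp [e₃four, EuclideanSpace.inner_single_left]
  rw [hn, hip]
  simp only [RCLike.ofReal_one, one_pow, div_one]
  module

/-- The coordinates of the reflected point: `(x, y, z, w) ↦ (x, y, z, -w)`. [folklore] -/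
theorem reflectFourthCLE_apply_coord (p : 𝔼 4) (i : Fin 4) :
    reflectFourthCLE p i = if i = 3 then -p 3 else p i := by
  rw [reflectFourthCLE_apply]
  simp only [PiLp.sub_apply, PiLp.smul_apply, e₃four_apply, smul_eq_mul]
  split_ifs with h
  · subst h; ring
  · ring

/-- The Jacobian determinant of the reflection is `-1` (Mathlib `Submodule.det_reflection`:
`det = (-1) ^ finrank (ℝ ∙ e₃) = -1`). [folklore] -/
theorem det_reflectFourthCLE :
    LinearMap.det ((reflectFourthCLE : 𝔼 4 →L[ℝ] 𝔼 4) : 𝔼 4 →ₗ[ℝ] 𝔼 4) = -1 := by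
  have h := Submodule.det_reflection (K := (ℝ ∙ e₃four)ᗮ)
  rw [Submodule.orthogonal_orthogonal, finrank_span_singleton e₃four_ne_zero, pow_one] at h
  exact h

/-- The reflection as a self-diffeomorphism of the model manifold `ℝ⁴`. [folklore] -/
def reflectFourth : 𝔼 4 ≃ₘ⟮𝓡 4, 𝓡 4⟯ 𝔼 4 := reflectFourthCLE.toDiffeomorph

/-- The reflection diffeomorphism is the reflection isometry as a map (definitional).
[folklore] -/
@[simp] theorem reflectFourth_apply (p : 𝔼 4) : reflectFourth p = reflectFourthCLE p := rfl

/-- The reflection fixes the points of the mirror `{w = 0}`. [folklore] -/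
theorem reflectFourth_eq_self_of_apply_three_eq_zero {p : 𝔼 4} (hp : p 3 = 0) :
    reflectFourth p = p := by
  rw [reflectFourth_apply, reflectFourthCLE_apply, hp]
  simp

/-- The differential of the reflection is the reflection. [folklore] -/
theorem mfderiv_reflectFourth (p : 𝔼 4) :
    mfderiv (𝓡 4) (𝓡 4) reflectFourth p = (reflectFourthCLE : 𝔼 4 →L[ℝ] 𝔼 4) := by
  show mfderiv 𝓘(ℝ, 𝔼 4) 𝓘(ℝ, 𝔼 4) (reflectFourthCLE : 𝔼 4 → 𝔼 4) p = _
  rw [mfderiv_eq_fderiv, ContinuousLinearEquiv.fderiv]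

/-- The Jacobian determinant of the reflection diffeomorphism is `-1` at every point.
[folklore] -/
theorem det_mfderiv_reflectFourth (p : 𝔼 4) :
    LinearMap.det (M := 𝔼 4) (mfderiv (𝓡 4) (𝓡 4) reflectFourth p).toLinearMap = -1 := by
  have h := det_reflectFourthCLE
  rw [← mfderiv_reflectFourth p] at h
  exact h

/-- **The reflection reverses the standard orientation of `ℝ⁴`** at every point: its Jacobian
determinant is `-1 < 0` (Hirsch, *Differential Topology* (1976), Ch. 4 §4, p. 105: "reflection
in a hyperplane always reverses orientation"). [cite: HirschDT1976, Ch. 4 §4, p. 105] -/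
theorem reflectFourth_isOrientationReversing :
    reflectFourth.IsOrientationReversing (SmoothOrientation.euclidean 4)
      (SmoothOrientation.euclidean 4) := by
  intro p
  have h1 : (-SmoothOrientation.euclidean 4) (reflectFourth p) ≠
      SmoothOrientation.euclidean 4 p := by
    rw [SmoothOrientation.neg_apply, SmoothOrientation.euclidean_apply,
      SmoothOrientation.euclidean_apply]
    exact (Module.Ray.ne_neg_self _).symm
  have h2 : ¬ 0 < LinearMap.det (M := 𝔼 4) (mfderiv (𝓡 4) (𝓡 4) reflectFourth p).toLinearMap := by
    rw [det_mfderiv_reflectFourth]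
    norm_num
  exact iff_of_false h1 h2

end Reflection

/-! ### §2 The mirror symmetry of an even regular sublevel set `{G ≤ c} ⊂ ℝ⁴` -/

section Mirror

namespace RegularSublevel

variable {G : 𝔼 4 → ℝ} {c : ℝ} (h : IsRegularLevel (𝓡 4) G c)
  (hG : ∀ p, G (reflectFourth p) = G p)

/-- **The mirror symmetry `R₀` of `{G ≤ c}`** for `G` invariant under `w ↦ -w`: the
self-diffeomorphism induced by the reflection (`RegularSublevel.mapDiffeomorph`). [folklore] -/
def mirror₄ : RegularSublevel h ≃ₘ⟮𝓡∂ 4, 𝓡∂ 4⟯ RegularSublevel h :=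
  mapDiffeomorph h h reflectFourth hG

/-- **The mirror symmetry `r₀` of the level hypersurface `{G = c} = ∂{G ≤ c}`**: the
restriction of `R₀` (`RegularSublevel.boundaryRestrictDiffeomorph`). [folklore] -/
def boundaryMirror₄ :
    (𝓡∂ 4).boundary (RegularSublevel h) ≃ₘ⟮𝓡 3, 𝓡 3⟯ (𝓡∂ 4).boundary (RegularSublevel h) :=
  boundaryRestrictDiffeomorph h h reflectFourth hG

/-- `R₀` is the reflection on points of `ℝ⁴`. [folklore] -/
theorem incl_mirror₄ (p : RegularSublevel h) : incl h (mirror₄ h hG p) = reflectFourth (incl h p) :=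
  rfl

/-- `r₀` is the reflection on points of `ℝ⁴`. [folklore] -/
theorem incl_boundaryMirror₄ (z : (𝓡∂ 4).boundary (RegularSublevel h)) :
    incl h (boundaryMirror₄ h hG z).1 = reflectFourth (incl h z.1) :=
  rfl

/-- `R₀` extends `r₀`: `R₀ ∘ incl = incl ∘ r₀` for the boundary datum of `{G ≤ c}`
(`RegularSublevel.mapDiffeomorph_comp_incl`). [folklore] -/
theorem mirror₄_incl (z : (𝓡∂ 4).boundary (RegularSublevel h)) :
    mirror₄ h hG ((boundaryData h).incl z) = (boundaryData h).incl (boundaryMirror₄ h hG z) := rfl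

/-- **`r₀` extends over `{G ≤ c}`** (by `R₀`), in the vocabulary of
`Literature.Topology.FourManifolds.BoundaryData.DiffeoExtends` (`SPC4HandlesProofs.lean`). [folklore] -/
theorem diffeoExtends_boundaryMirror₄ : (boundaryData h).DiffeoExtends (boundaryMirror₄ h hG) :=
  ⟨mirror₄ h hG, funext fun z => mirror₄_incl h hG z⟩

/-- **`r₀` fixes the boundary points of the mirror `{w = 0}`.** [folklore] -/
theorem boundaryMirror₄_eq_self_of_apply_three_eq_zero (z : (𝓡∂ 4).boundary (RegularSublevel h))
    (hz : incl h z.1 3 = 0) : boundaryMirror₄ h hG z = z := by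
  apply Subtype.ext
  apply injective_incl h
  rw [incl_boundaryMirror₄, reflectFourth_eq_self_of_apply_three_eq_zero hz]

/-- **`R₀` reverses the orientation of `{G ≤ c}` induced from `ℝ⁴`**
(`RegularSublevel.orientation`): `incl ∘ R₀ = R ∘ incl` with `incl` orientation preserving
(`RegularSublevel.isOrientationPreserving_incl`) and the ambient reflection `R` orientation
reversing (`reflectFourth_isOrientationReversing`); cancel `incl`
(`IsOrientationPreserving.of_comp_left`).  Hirsch (1976), Ch. 4 §4.
[cite: HirschDT1976, Ch. 4 §4, pp. 101–105] -/
theorem mirror₄_isOrientationReversing :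
    (mirror₄ h hG).IsOrientationReversing (orientation h (SmoothOrientation.euclidean 4))
      (orientation h (SmoothOrientation.euclidean 4)) := by
  have hn : (∞ : WithTop ℕ∞) ≠ 0 := by simp
  set o := orientation h (SmoothOrientation.euclidean 4) with ho
  have hincl : IsOrientationPreserving o (SmoothOrientation.euclidean 4) (incl h) :=
    isOrientationPreserving_incl h (SmoothOrientation.euclidean 4)
  have hR : IsOrientationPreserving (SmoothOrientation.euclidean 4)
      (-SmoothOrientation.euclidean 4) reflectFourth := reflectFourth_isOrientationReversing
  have hdetR : ∀ y : 𝔼 4, LinearMap.det (M := 𝔼 4)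
      (mfderiv (𝓡 4) (𝓡 4) reflectFourth y).toLinearMap ≠ 0 := fun y => by
    rw [det_mfderiv_reflectFourth]; norm_num
  -- `R ∘ incl` preserves `(o, -std)`
  have hcomp : IsOrientationPreserving o (-SmoothOrientation.euclidean 4)
      (reflectFourth ∘ incl h) :=
    IsOrientationPreserving.comp_holds hR hincl (reflectFourth.mdifferentiable hn)
      ((contMDiff_incl h).mdifferentiable hn) hdetR (det_mfderiv_incl_ne_zero h)
  -- `R ∘ incl = incl ∘ R₀`
  have heq : (reflectFourth ∘ incl h : RegularSublevel h → 𝔼 4) = incl h ∘ mirror₄ h hG := rfl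
  rw [heq] at hcomp
  have hincl' : IsOrientationPreserving (-o) (-SmoothOrientation.euclidean 4) (incl h) := by
    rw [isOrientationPreserving_neg_neg_iff]; exact hincl
  exact IsOrientationPreserving.of_comp_left hcomp hincl'
    ((contMDiff_incl h).mdifferentiable hn) ((mirror₄ h hG).mdifferentiable hn)
    (det_mfderiv_incl_ne_zero h) ((mirror₄ h hG).det_mfderiv_ne_zero hn)

/-- **`r₀` reverses the boundary orientation of the level hypersurface `{G = c}`**
(`Diffeomorph.isOrientationReversing_boundaryMap`: the boundary restriction of an
orientation-reversing diffeomorphism is orientation reversing for the boundary orientations,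
`BoundaryOrientation.lean`).  Hirsch (1976), Ch. 4 §4, p. 103.
[cite: HirschDT1976, Ch. 4 §4, p. 103] -/
theorem boundaryMirror₄_isOrientationReversing :
    (boundaryMirror₄ h hG).IsOrientationReversing
      (orientation h (SmoothOrientation.euclidean 4)).boundary
      (orientation h (SmoothOrientation.euclidean 4)).boundary :=
  Diffeomorph.isOrientationReversing_boundaryMap (mirror₄ h hG) (ρ := boundaryMirror₄ h hG)
    (fun _ => rfl) (mirror₄_isOrientationReversing h hG)

/-- **`r₀` reverses every smooth orientation of the connected boundary `{G = c}`**: it reverses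
the boundary orientation induced from `ℝ⁴` (`boundaryMirror₄_isOrientationReversing`), and on a
connected manifold every orientation is `±` this one
(`SmoothOrientation.eq_or_eq_neg_of_connectedSpace_holds`).  Hirsch (1976), Ch. 4 §4.
[cite: HirschDT1976, Ch. 4 §4, pp. 103–105] -/
theorem boundaryMirror₄_isOrientationReversing_all
    [ConnectedSpace ((𝓡∂ 4).boundary (RegularSublevel h))]
    (o : SmoothOrientation (𝓡 3) ((𝓡∂ 4).boundary (RegularSublevel h))) :
    (boundaryMirror₄ h hG).IsOrientationReversing o o := by
  set o₁ := (orientation h (SmoothOrientation.euclidean 4)).boundary with ho₁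
  have h₁ : (boundaryMirror₄ h hG).IsOrientationReversing o₁ o₁ :=
    boundaryMirror₄_isOrientationReversing h hG
  rcases SmoothOrientation.eq_or_eq_neg_of_connectedSpace_holds o₁ o with h' | h'
  · rw [h']; exact h₁
  · rw [h']; exact (isOrientationPreserving_neg_neg_iff o₁ (-o₁) _).mpr h₁

/-- **The boundary of a compact connected even `1`-handlebody `{G ≤ c} ⊂ ℝ⁴` is connected**
(`connectedSpace_boundary_of_isHandlebodyOfIndexLE_one_holds`,
`SPC4OneHandlebodyBoundaryProofs.lean`, for the boundary datum `RegularSublevel.boundaryData`;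
a handle decomposition of type `(1, k)` has no handles of index `≥ 2`).  Kirby (1989), Ch. I §2,
p. 8 (`∂(♮ᵏ S¹ × B³) = #ᵏ S¹ × S²`). [cite: Kirby1989, Ch. I §2, p. 8] -/
theorem connectedSpace_boundary_four [CompactSpace (RegularSublevel h)]
    [ConnectedSpace (RegularSublevel h)] {k : ℕ}
    (hk : HasHandleDecomposition 3 (RegularSublevel h) (handleCount 1 k)) :
    ConnectedSpace ((𝓡∂ 4).boundary (RegularSublevel h)) :=
  connectedSpace_boundary_of_isHandlebodyOfIndexLE_one_holds (RegularSublevel h)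
    (HasHandleDecomposition.isHandlebodyOfIndexLE_holds (n := 3) (k := 1) (W := RegularSublevel h)
      hk fun j hj => handleCount_of_two_le 1 k (by omega))
    (isOrientable h (isOrientable_euclideanSpace 4)) (boundaryData h)

end RegularSublevel

end Mirror

/-! ### §3 The models `{q(x, y) + z² + w² ≤ c}`: SYMMᴹ up to the action on `π₁` -/

open PlanarThickening SolidThickening

namespace IsHoledDiscMorseFunction

variable {g : ℕ} {q : 𝔼 2 → ℝ} {c : ℝ} (h : IsHoledDiscMorseFunction g q c)
include h

omit h in
/-- `G = q(x, y) + z² + w²` is invariant under the reflection `w ↦ -w` of `ℝ⁴`. [folklore] -/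
theorem thicken₄_thicken_reflectFourth (p : 𝔼 4) :
    thicken₄ (thicken q) (reflectFourth p) = thicken₄ (thicken q) p :=
  thicken₄_even (thicken q) p (reflectFourth p)
    (by rw [reflectFourth_apply, reflectFourthCLE_apply_coord]; simp)
    (by rw [reflectFourth_apply, reflectFourthCLE_apply_coord]; simp)
    (by rw [reflectFourth_apply, reflectFourthCLE_apply_coord]; simp)
    (by rw [reflectFourth_apply, reflectFourthCLE_apply_coord]; simp)

omit h in
/-- **The base point of the model on the mirror**: `z₀ = (u₀, 0, 0)` for a point `u₀` of the
level `{q = c}` lies on the boundary `{q + z² + w² = c}` (its fibre circle is degenerate).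
[folklore] -/
def basePoint₄ (h : IsHoledDiscMorseFunction g q c) {u₀ : 𝔼 2} (hu₀ : q u₀ = c) :
    (𝓡∂ 4).boundary h.FourThickening :=
  ⟨RegularSublevel.mk h.isRegularLevel₄ (lift₃ (lift u₀))
      (by rw [thicken₄_lift₃, thicken_lift]; exact hu₀.le), by
    rw [RegularSublevel.mem_boundary_iff]
    show thicken₄ (thicken q) (lift₃ (lift u₀)) = c
    rw [thicken₄_lift₃, thicken_lift]; exact hu₀⟩

omit h in
/-- The base point has coordinates `(u₀, 0, 0)` in `ℝ⁴` (definitional). [folklore] -/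
@[simp] theorem incl_basePoint₄ (h : IsHoledDiscMorseFunction g q c) {u₀ : 𝔼 2} (hu₀ : q u₀ = c) :
    RegularSublevel.incl h.isRegularLevel₄ (h.basePoint₄ hu₀).1 = lift₃ (lift u₀) := rfl

omit h in
/-- The base point lies on the mirror `{w = 0}`. [folklore] -/
theorem incl_basePoint₄_apply_three (h : IsHoledDiscMorseFunction g q c) {u₀ : 𝔼 2}
    (hu₀ : q u₀ = c) : RegularSublevel.incl h.isRegularLevel₄ (h.basePoint₄ hu₀).1 3 = 0 := by
  rw [incl_basePoint₄]; simp

omit h in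
/-- A base point of the model on the mirror exists (`IsHoledDiscMorseFunction.exists_apply_eq`:
the level `{q = c}` is nonempty). [folklore] -/
theorem exists_basePoint_four (h : IsHoledDiscMorseFunction g q c) :
    ∃ z₀ : (𝓡∂ 4).boundary h.FourThickening, RegularSublevel.incl h.isRegularLevel₄ z₀.1 3 = 0 := by
  obtain ⟨u₀, hu₀⟩ := h.exists_apply_eq
  exact ⟨h.basePoint₄ hu₀, h.incl_basePoint₄_apply_three hu₀⟩

/-- **SYMMᴹ up to `π₁` for the model `Y = {q(x, y) + z² + w² ≤ c}`.**  The restriction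
`ρ₀` of the reflection `w ↦ -w` to the boundary `∂Y = {q + z² + w² = c}` extends over `Y`,
reverses every smooth orientation of `∂Y`, and fixes the points of `∂Y ∩ {w = 0}` — in
particular a base point `z₀` (`exists_basePoint_four`).  Laudenbach–Poénaru (1972), §2, p. 342
(the orientation-reversing `F` with `(F₁)_# = id`, here on the `Y_p` side); Juhász (2023),
§3.5, p. 97 one dimension lower (cf. `HandlebodyMirrorSymmetry.lean`); the reflection argument
is standard (Hirsch (1976), Ch. 4 §4). [folklore] -/
theorem fourThickening_symm :
    (RegularSublevel.boundaryData h.isRegularLevel₄).DiffeoExtends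
        (RegularSublevel.boundaryMirror₄ h.isRegularLevel₄ (thicken₄_thicken_reflectFourth (q := q))) ∧
      (∀ o : SmoothOrientation (𝓡 3) ((𝓡∂ 4).boundary h.FourThickening),
        (RegularSublevel.boundaryMirror₄ h.isRegularLevel₄
          (thicken₄_thicken_reflectFourth (q := q))).IsOrientationReversing o o) ∧
      ∀ z : (𝓡∂ 4).boundary h.FourThickening, RegularSublevel.incl h.isRegularLevel₄ z.1 3 = 0 →
        RegularSublevel.boundaryMirror₄ h.isRegularLevel₄ (thicken₄_thicken_reflectFourth (q := q)) z = z := by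
  haveI := h.compactSpace_fourThickening
  haveI := h.connectedSpace_fourThickening
  haveI : ConnectedSpace ((𝓡∂ 4).boundary h.FourThickening) :=
    RegularSublevel.connectedSpace_boundary_four h.isRegularLevel₄
      h.hasHandleDecomposition_fourThickening
  exact ⟨RegularSublevel.diffeoExtends_boundaryMirror₄ _ _,
    RegularSublevel.boundaryMirror₄_isOrientationReversing_all _ _,
    RegularSublevel.boundaryMirror₄_eq_self_of_apply_three_eq_zero _ _⟩

/-- **The mirror symmetry fixes the base point `z₀ = (u₀, 0, 0)`.** [folklore] -/
theorem boundaryMirror₄_basePoint₄ {u₀ : 𝔼 2} (hu₀ : q u₀ = c) :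
    RegularSublevel.boundaryMirror₄ h.isRegularLevel₄ (thicken₄_thicken_reflectFourth (q := q))
      (h.basePoint₄ hu₀) = h.basePoint₄ hu₀ :=
  RegularSublevel.boundaryMirror₄_eq_self_of_apply_three_eq_zero _ _ _
    (h.incl_basePoint₄_apply_three hu₀)

end IsHoledDiscMorseFunction

/-- **Mirror-symmetric `4`-dimensional `1`-handlebody models in every genus (SYMMᴹ up to
`π₁`).**  For every `k` there are a compact connected orientable smooth `4`-manifold with
boundary `V₀` with one `0`-handle and `k` `1`-handles (a regular sublevel set
`{q(x, y) + z² + w² ≤ c} ⊂ ℝ⁴`, `ThickenedHandlebodyFour.lean`), a boundary datum `b₀`, a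
self-diffeomorphism `ρ₀` of `b₀.carrier` and a point `z₀` such that `ρ₀` extends over `V₀`,
reverses every smooth orientation of `b₀.carrier` and fixes `z₀` — the clause `k` of
`Literature.Topology.FourManifolds.exists_oneHandlebody_diffeoExtends_isOrientationReversing`
(universe `0`) except for the triviality of `ρ₀` on `π₁(b₀.carrier, z₀)`, which is the sequel.
Cf. Laudenbach–Poénaru (1972), §2, p. 342 (diagram (5), the analogous `F` on the `X_p` side);
Juhász (2023), §3.5, p. 97 one dimension lower; Hirsch (1976), Ch. 4 §4. [folklore] -/
theorem exists_oneHandlebody_mirror_four (k : ℕ) :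
    ∃ (V₀ : Type) (_ : TopologicalSpace V₀) (_ : T2Space V₀) (_ : SecondCountableTopology V₀)
      (_ : CompactSpace V₀) (_ : ConnectedSpace V₀) (_ : ChartedSpace (EuclideanHalfSpace 4) V₀)
      (_ : IsManifold (𝓡∂ 4) ∞ V₀) (b₀ : BoundaryData (𝓡∂ 4) V₀ (𝓡 3))
      (ρ₀ : b₀.carrier ≃ₘ⟮𝓡 3, 𝓡 3⟯ b₀.carrier),
      HasHandleDecomposition 3 V₀ (handleCount 1 k) ∧ IsOrientable (𝓡∂ 4) V₀ ∧
      b₀.DiffeoExtends ρ₀ ∧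
      (∀ o : SmoothOrientation (𝓡 3) b₀.carrier, ρ₀.IsOrientationReversing o o) ∧
      ∃ z₀ : b₀.carrier, ρ₀ z₀ = z₀ := by
  obtain ⟨q, c, h⟩ := exists_isHoledDiscMorseFunction k
  obtain ⟨hext, hrev, hfix⟩ := h.fourThickening_symm
  obtain ⟨z₀, hz₀⟩ := h.exists_basePoint_four
  exact ⟨h.FourThickening, inferInstance, inferInstance, inferInstance, h.compactSpace_fourThickening,
    h.connectedSpace_fourThickening, inferInstance, inferInstance,
    RegularSublevel.boundaryData h.isRegularLevel₄, _, h.hasHandleDecomposition_fourThickening,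
    h.isOrientable_fourThickening, hext, hrev, z₀, hfix z₀ hz₀⟩

end Literature.Topology.FourManifolds
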